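import Mathlib.Analysis.Complex.Basic
import Mathlib.Algebra.Polynomial.Derivative
import Mathlib.Algebra.Polynomial.AlgebraMap
import Mathlib.Algebra.Polynomial.Monic
import Mathlib.Algebra.Polynomial.Roots
import Mathlib.Algebra.Polynomial.Degree.Lemmas
import Mathlib.Algebra.Polynomial.FieldDivision
import Mathlib.Analysis.Complex.Polynomial.Basic
import HarnessLib

/-!
# The local Riemann hypothesis (archimedean place): the spectral/Jacobi-matrix argument

The *local Riemann hypothesis* of Bump–Ng and Bump–Choi–Kurlberg–Vaaler
[cite: BumpEtAl2000, Thm 1] says: if `f_n` is the `n`-th Hermite (harmonic-oscillator)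
eigenfunction on `ℝ`, its Mellin transform `M_n(s) = ∫₀^∞ f_n(x) x^{s-1} dx` equals the Tate
local factor `π^{-(s+δ)/2} Γ((s+δ)/2)` (`δ = n mod 2`) times a polynomial `p_n(s)`, and
**all zeros of `p_n` lie on the line `Re s = 1/2`** (and are simple).

Srednicki [cite: Srednicki2011, §2] gave a "Hilbert–Pólya" proof: writing `n = 2K + δ`, the
polynomials `p_{2K+δ}(1/2 + iE)` are, up to the constant `(2i)^K`, the characteristic polynomials
`P_K(E)` of the Berry–Keating Hamiltonian `(xp+px)/2` compressed to the first `K` oscillator states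
of parity `δ`, i.e. they satisfy the Jacobi (three-term) recursion
`P_{k+1}(E) = E·P_k(E) − β_k·P_{k−1}(E)` with `β_k = |b_k|² = (2k+δ)(2k+δ−1)/4 > 0`
(Srednicki's eq. for `φ_{k+1}` and the tridiagonal determinant formula for `φ_K`); a Hermitian
tridiagonal matrix has real spectrum, whence `E ∈ ℝ`, i.e. `Re s = 1/2`.

This file kernel-checks the ALGEBRAIC half of that argument, in a form that needs no square
roots and no matrices: for ANY real weights `β_k > 0` the Jacobi recursion polynomials have only
real, simple zeros (`jacobiPoly_im_eq_zero_of_aeval_eq_zero`,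
`jacobiPoly_derivative_eval_ne_zero`) — the proof is the Hermitian-matrix argument written in
the coordinates of the recursion (the positive quantity `S_k` below is the weighted norm of
Srednicki's eigenvector `(φ_0,…,φ_{K-1})`) — and then, for the Hermite weights, the polynomials
`hermiteMellinPoly δ K ∈ ℤ[X]` defined by the parity-preserving Mellin recursion
`Q_{k+1}(s) = (2s−1)·Q_k(s) + (2k+δ)(2k+δ−1)·Q_{k−1}(s)`, `Q_0 = 1`, `Q_1 = 2s−1`,
satisfy `Q_K(1/2+iE) = (2i)^K P_K(E)` (`aeval_hermiteMellinPoly`), hence have all their zeros on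
`Re s = 1/2`, simple, and obey the functional equation `Q_K(1−s) = (−1)^K Q_K(s)`
(`hermiteMellinPoly_re_eq_half`, `hermiteMellinPoly_derivative_ne_zero`,
`hermiteMellinPoly_one_sub`) — this is [cite: BumpEtAl2000, Thm 1] for the polynomial factor,
with BCKV's `p_{2K+δ} = c_{K,δ} · Q_K` (`c` a nonzero constant).

Normalisation: with Mathlib's probabilists' Hermite polynomials `He_n = Polynomial.hermite n` and
`ψ_n(x) = He_n(x) e^{−x²/4}`, the Mellin transforms `Φ_n = M[ψ_n]` obey
`Φ_{n+2}(s) = (2s−1) Φ_n(s) + n(n−1) Φ_{n−2}(s)` (ladder identity + `M[x f'](s) = −s·M[f](s)`), so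
`Φ_{2K+δ} = Q_K · Φ_δ`; BCKV's `f_n(x) = κ_n H_n(√(2π)x)e^{−πx²} = const·ψ_n(2√π·x)` only rescales
`x`, multiplying the Mellin transform by the zero-free factor `(2√π)^{−s}`.

What is deliberately NOT here: the analytic identification `M[ψ_{2K+δ}] = Q_K · M[ψ_δ]` itself
(Mellin transforms, integration by parts) — this file proves the statement about the polynomial
factor, which is the content of [cite: BumpEtAl2000, Thm 1]; the `p`-adic local Riemann
hypothesis (Kurlberg, part II); the general-`α` Laguerre case [cite: BumpEtAl2000, Thm 4]
(it is the same Jacobi argument with other positive weights and can be fed to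
`jacobiPoly_im_eq_zero_of_aeval_eq_zero` once its recursion coefficients are recorded).
-/

namespace Literature.NumberTheory.LFunctions

open Polynomial Complex
open scoped ComplexConjugate

namespace LocalRH

section Jacobi

variable {R : Type*} [CommRing R]

/-- The Jacobi (three-term) recursion polynomials attached to a weight sequence `β`:
`P_0 = 1`, `P_1 = X`, `P_{k+2} = X·P_{k+1} − β_{k+1}·P_k`. For real `β_k > 0` these are the
characteristic polynomials of the `K × K` Hermitian tridiagonal (Jacobi) matrices with zero
diagonal and `|b_k|² = β_k` [cite: Srednicki2011, §2, determinant formula for φ_K]. -/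
noncomputable def jacobiPoly (β : ℕ → R) : ℕ → R[X]
  | 0 => 1
  | 1 => X
  | (k + 2) => X * jacobiPoly β (k + 1) - C (β (k + 1)) * jacobiPoly β k

/-- `P_0 = 1`. [cite: Srednicki2011, §2] -/
@[simp] theorem jacobiPoly_zero (β : ℕ → R) : jacobiPoly β 0 = 1 := rfl
/-- `P_1 = X`. [cite: Srednicki2011, §2] -/
@[simp] theorem jacobiPoly_one (β : ℕ → R) : jacobiPoly β 1 = X := rfl
/-- The recursion `P_{k+2} = X·P_{k+1} − β_{k+1}·P_k`. [cite: Srednicki2011, §2] -/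
theorem jacobiPoly_add_two (β : ℕ → R) (k : ℕ) :
    jacobiPoly β (k + 2) = X * jacobiPoly β (k + 1) - C (β (k + 1)) * jacobiPoly β k := rfl

/-- `P_k` is monic of degree `k`. [cite: Srednicki2011, §2] -/
theorem jacobiPoly_monic_and_natDegree [Nontrivial R] (β : ℕ → R) :
    ∀ k, (jacobiPoly β k).Monic ∧ (jacobiPoly β k).natDegree = k
  | 0 => by simp
  | 1 => by simp [monic_X]
  | (k + 2) => by
    obtain ⟨hm1, hd1⟩ := jacobiPoly_monic_and_natDegree β (k + 1)
    obtain ⟨hm0, hd0⟩ := jacobiPoly_monic_and_natDegree β k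
    have hXm : (X * jacobiPoly β (k + 1)).Monic := monic_X.mul hm1
    have hXd : (X * jacobiPoly β (k + 1)).natDegree = k + 2 := by
      rw [(monic_X (R := R)).natDegree_mul hm1, natDegree_X, hd1]; ring
    have hlt' : (C (β (k + 1)) * jacobiPoly β k).natDegree < (X * jacobiPoly β (k + 1)).natDegree := by
      rw [hXd]
      exact lt_of_le_of_lt (natDegree_C_mul_le _ _) (by rw [hd0]; omega)
    have hlt : (C (β (k + 1)) * jacobiPoly β k).degree < (X * jacobiPoly β (k + 1)).degree :=
      degree_lt_degree hlt'
    refine ⟨hXm.sub_of_left hlt, ?_⟩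
    rw [jacobiPoly_add_two, natDegree_sub_eq_left_of_natDegree_lt hlt', hXd]

/-- `P_k` is monic. [cite: Srednicki2011, §2] -/
theorem jacobiPoly_monic [Nontrivial R] (β : ℕ → R) (k : ℕ) : (jacobiPoly β k).Monic :=
  (jacobiPoly_monic_and_natDegree β k).1

/-- `P_k` has degree `k` (the number of retained oscillator levels). [cite: Srednicki2011, §2] -/
theorem jacobiPoly_natDegree [Nontrivial R] (β : ℕ → R) (k : ℕ) :
    (jacobiPoly β k).natDegree = k :=
  (jacobiPoly_monic_and_natDegree β k).2

/-- The evaluated recursion over `ℂ`: `P_{k+2}(E) = E·P_{k+1}(E) − β_{k+1}·P_k(E)`.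
[cite: Srednicki2011, §2] -/
theorem aeval_jacobiPoly_add_two (β : ℕ → ℝ) (E : ℂ) (k : ℕ) :
    aeval E (jacobiPoly β (k + 2)) =
      E * aeval E (jacobiPoly β (k + 1)) - (β (k + 1) : ℂ) * aeval E (jacobiPoly β k) := by
  rw [jacobiPoly_add_two, map_sub, map_mul, map_mul, aeval_X, aeval_C]
  rfl

/-- Srednicki's positive quantity: `S_0 = 1`, `S_{k+1} = |P_{k+1}(E)|² + β_{k+1}·S_k` — the
weighted squared norm of the would-be eigenvector `(P_0(E), …, P_k(E))` of the Jacobi matrix.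
[cite: Srednicki2011, §2] -/
noncomputable def normSeq (β : ℕ → ℝ) (E : ℂ) : ℕ → ℝ
  | 0 => 1
  | (k + 1) => Complex.normSq (aeval E (jacobiPoly β (k + 1))) + β (k + 1) * normSeq β E k

/-- `S_k > 0` as soon as all weights `β_{j}` (`j ≥ 1`) are positive. [cite: Srednicki2011, §2] -/
theorem normSeq_pos {β : ℕ → ℝ} (hβ : ∀ k, 0 < β (k + 1)) (E : ℂ) : ∀ k, 0 < normSeq β E k
  | 0 => by simp [normSeq]
  | (k + 1) => by
    have := normSeq_pos hβ E k
    have h0 : 0 ≤ Complex.normSq (aeval E (jacobiPoly β (k + 1))) := Complex.normSq_nonneg _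
    simp only [normSeq]
    nlinarith [hβ k]

/-- The key identity (imaginary part of the Hermitian form along the recursion):
`Im (P_{k+1}(E) · conj P_k(E)) = Im E · S_k`. [cite: Srednicki2011, §2] -/
theorem im_aeval_succ_mul_conj (β : ℕ → ℝ) (E : ℂ) :
    ∀ k, (aeval E (jacobiPoly β (k + 1)) * conj (aeval E (jacobiPoly β k))).im =
      E.im * normSeq β E k
  | 0 => by simp [normSeq]
  | (k + 1) => by
    have ih := im_aeval_succ_mul_conj β E k
    rw [aeval_jacobiPoly_add_two]
    simp only [normSeq]
    set u1 := aeval E (jacobiPoly β (k + 1)) with hu1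
    set u0 := aeval E (jacobiPoly β k) with hu0
    simp only [Complex.mul_im, Complex.mul_re, Complex.sub_re, Complex.sub_im, Complex.conj_re,
      Complex.conj_im, Complex.ofReal_re, Complex.ofReal_im, Complex.normSq_apply] at ih ⊢
    linear_combination (β (k + 1)) * ih

/-- **Jacobi recursions with positive weights have only real zeros** (the spectral half of the
local Riemann hypothesis): if `β_k > 0` for `k ≥ 1` and `P_K(E) = 0` for some `E ∈ ℂ`, then
`E ∈ ℝ`. This is "a Hermitian (Jacobi) matrix has real eigenvalues", run in the coordinates of
the recursion. [cite: Srednicki2011, §2] -/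
theorem jacobiPoly_im_eq_zero_of_aeval_eq_zero {β : ℕ → ℝ} (hβ : ∀ k, 0 < β (k + 1)) {K : ℕ}
    {E : ℂ} (hE : aeval E (jacobiPoly β K) = 0) : E.im = 0 := by
  cases K with
  | zero => simp at hE
  | succ k =>
    have h := im_aeval_succ_mul_conj β E k
    rw [hE, zero_mul, Complex.zero_im] at h
    have hS := normSeq_pos hβ E k
    rcases mul_eq_zero.mp h.symm with h1 | h1
    · exact h1
    · exact absurd h1 hS.ne'

/-- The discrete Wronskian `W_k = P_{k+1}'(E)·P_k(E) − P_{k+1}(E)·P_k'(E)` (real `E`).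
[cite: BumpEtAl2000, Thm 1, "the zeros of these are real and simple"] -/
noncomputable def wronskian (β : ℕ → ℝ) (E : ℝ) (k : ℕ) : ℝ :=
  (derivative (jacobiPoly β (k + 1))).eval E * (jacobiPoly β k).eval E -
    (jacobiPoly β (k + 1)).eval E * (derivative (jacobiPoly β k)).eval E

/-- `W_{k+1} = P_{k+1}(E)² + β_{k+1}·W_k`. [cite: BumpEtAl2000, Thm 1] -/
theorem wronskian_succ (β : ℕ → ℝ) (E : ℝ) (k : ℕ) :
    wronskian β E (k + 1) = ((jacobiPoly β (k + 1)).eval E) ^ 2 + β (k + 1) * wronskian β E k := by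
  simp only [wronskian, jacobiPoly_add_two, derivative_sub, derivative_mul, derivative_X,
    derivative_C, eval_sub, eval_add, eval_mul, eval_X, eval_C, one_mul, zero_mul, zero_add]
  ring

/-- `W_k > 0` for real `E` when the weights are positive. [cite: BumpEtAl2000, Thm 1] -/
theorem wronskian_pos {β : ℕ → ℝ} (hβ : ∀ k, 0 < β (k + 1)) (E : ℝ) : ∀ k, 0 < wronskian β E k
  | 0 => by simp [wronskian]
  | (k + 1) => by
    rw [wronskian_succ]
    nlinarith [wronskian_pos hβ E k, hβ k, sq_nonneg ((jacobiPoly β (k + 1)).eval E)]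

/-- **The real zeros are simple**: for positive weights and real `E`, `P_K(E) = 0` forces
`P_K'(E) ≠ 0`. [cite: BumpEtAl2000, Thm 1] -/
theorem jacobiPoly_derivative_eval_ne_zero {β : ℕ → ℝ} (hβ : ∀ k, 0 < β (k + 1)) {K : ℕ}
    {E : ℝ} (hE : (jacobiPoly β K).eval E = 0) : (derivative (jacobiPoly β K)).eval E ≠ 0 := by
  cases K with
  | zero => simp at hE
  | succ k =>
    intro hD
    have hW := wronskian_pos hβ E k
    simp only [wronskian, hE, hD, zero_mul, sub_zero] at hW
    exact lt_irrefl _ hW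

/-- Complex form of simplicity: for positive weights, a complex zero `E` of `P_K` (necessarily
real) is not a zero of `P_K'`. [cite: BumpEtAl2000, Thm 1] -/
theorem jacobiPoly_derivative_aeval_ne_zero {β : ℕ → ℝ} (hβ : ∀ k, 0 < β (k + 1)) {K : ℕ}
    {E : ℂ} (hE : aeval E (jacobiPoly β K) = 0) : aeval E (derivative (jacobiPoly β K)) ≠ 0 := by
  have him := jacobiPoly_im_eq_zero_of_aeval_eq_zero hβ hE
  have hEre : (E.re : ℂ) = E := by
    apply Complex.ext <;> simp [him]
  have key : ∀ (p : ℝ[X]) (x : ℝ), aeval (x : ℂ) p = ((p.eval x : ℝ) : ℂ) := fun p x => by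
    rw [← Complex.coe_algebraMap, aeval_algebraMap_apply_eq_algebraMap_eval]
  rw [← hEre, key] at hE ⊢
  have hE' : (jacobiPoly β K).eval E.re = 0 := by exact_mod_cast hE
  have h := jacobiPoly_derivative_eval_ne_zero hβ hE'
  exact_mod_cast h

end Jacobi

section Hermite

/-- Srednicki's weights for parity `δ ∈ {0,1}`: `β_k = |b_k|² = (2k+δ)(2k+δ−1)/4`, the squared
off-diagonal entries of `(xp+px)/2 = (i/2)(a†a† − aa)` in the oscillator basis of parity `δ`.
[cite: Srednicki2011, §2, b_k = −(i/2)[(2k+δ)(2k+δ−1)]^{1/2}] -/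
noncomputable def hermiteWeight (δ : ℕ) (k : ℕ) : ℝ := (2 * k + δ) * (2 * k + δ - 1) / 4

/-- `β_{k+1} = (2k+2+δ)(2k+1+δ)/4 > 0`. [cite: Srednicki2011, §2, "b_k ≠ 0 for k > 0"] -/
theorem hermiteWeight_succ_pos (δ k : ℕ) : 0 < hermiteWeight δ (k + 1) := by
  have h : hermiteWeight δ (k + 1) = ((2 * k + 2 + δ) * (2 * k + 1 + δ) : ℝ) / 4 := by
    unfold hermiteWeight; push_cast; ring
  rw [h]; positivity

/-- Cast of the weight: `β_{k+1} = (2k+2+δ)(2k+1+δ)/4` in `ℂ`. [cite: Srednicki2011, §2] -/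
theorem hermiteWeight_succ_cast (δ k : ℕ) :
    ((hermiteWeight δ (k + 1) : ℝ) : ℂ) = (((2 * k + 2 + δ) * (2 * k + 1 + δ) : ℕ) : ℂ) / 4 := by
  unfold hermiteWeight; push_cast; ring

/-- The Hermite–Mellin polynomials `Q_K = hermiteMellinPoly δ K ∈ ℤ[X]` (variable `s`):
`Q_0 = 1`, `Q_1 = 2s − 1`, `Q_{k+2} = (2s−1)·Q_{k+1} + (2k+2+δ)(2k+1+δ)·Q_k` — the recursion
satisfied by the Mellin transforms `Φ_n(s) = ∫₀^∞ He_n(x) e^{−x²/4} x^{s−1} dx` in steps of two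
(`Φ_{n+2} = (2s−1)Φ_n + n(n−1)Φ_{n−2}`, from `x·ψ_n' + ψ_n/2 = (n(n−1)ψ_{n−2} − ψ_{n+2})/2` and
`M[xf'](s) = −sM[f](s)`), so that `Φ_{2K+δ} = Q_K · Φ_δ`; up to a nonzero constant `Q_K` is the
polynomial `p_{2K+δ}` of [cite: BumpEtAl2000, Thm 1] (their `M_n(s) = π^{-(s+δ)/2}Γ((s+δ)/2)·p_n(s)`
up to the normalising constants of `f_n`). -/
noncomputable def hermiteMellinPoly (δ : ℕ) : ℕ → ℤ[X]
  | 0 => 1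
  | 1 => 2 * X - 1
  | (k + 2) => (2 * X - 1) * hermiteMellinPoly δ (k + 1) +
      C (((2 * k + 2 + δ) * (2 * k + 1 + δ) : ℕ) : ℤ) * hermiteMellinPoly δ k

/-- `Q_0 = 1`. [cite: BumpEtAl2000, Thm 1] -/
@[simp] theorem hermiteMellinPoly_zero (δ : ℕ) : hermiteMellinPoly δ 0 = 1 := rfl
/-- `Q_1 = 2s − 1`. [cite: BumpEtAl2000, Thm 1] -/
@[simp] theorem hermiteMellinPoly_one (δ : ℕ) : hermiteMellinPoly δ 1 = 2 * X - 1 := rfl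
/-- The recursion `Q_{k+2} = (2s−1)·Q_{k+1} + (2k+2+δ)(2k+1+δ)·Q_k`. [cite: BumpEtAl2000, Thm 1] -/
theorem hermiteMellinPoly_add_two (δ k : ℕ) :
    hermiteMellinPoly δ (k + 2) = (2 * X - 1) * hermiteMellinPoly δ (k + 1) +
      C (((2 * k + 2 + δ) * (2 * k + 1 + δ) : ℕ) : ℤ) * hermiteMellinPoly δ k := rfl

/-- Evaluated recursion over `ℂ`. [cite: BumpEtAl2000, Thm 1] -/
theorem aeval_hermiteMellinPoly_add_two (δ k : ℕ) (s : ℂ) :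
    aeval s (hermiteMellinPoly δ (k + 2)) = (2 * s - 1) * aeval s (hermiteMellinPoly δ (k + 1)) +
      (((2 * k + 2 + δ) * (2 * k + 1 + δ) : ℕ) : ℂ) * aeval s (hermiteMellinPoly δ k) := by
  rw [hermiteMellinPoly_add_two]
  simp [map_ofNat]

/-- `Q_1(s) = 2s − 1`, evaluated. [cite: BumpEtAl2000, Thm 1] -/
@[simp] theorem aeval_hermiteMellinPoly_one (δ : ℕ) (s : ℂ) :
    aeval s (hermiteMellinPoly δ 1) = 2 * s - 1 := by
  simp [map_ofNat]

/-- **Srednicki's identification** `Q_K(1/2 + iE) = (2i)^K · P_K(E)`: on the critical line the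
Hermite–Mellin polynomial is the characteristic polynomial of the compressed Berry–Keating
Hamiltonian (Jacobi recursion with weights `(2k+δ)(2k+δ−1)/4`).
[cite: Srednicki2011, §2, eqs. for φ_{k+1} and φ_K] -/
theorem aeval_hermiteMellinPoly (δ : ℕ) (E : ℂ) : ∀ K,
    aeval (1 / 2 + I * E) (hermiteMellinPoly δ K) =
      (2 * I) ^ K * aeval E (jacobiPoly (hermiteWeight δ) K)
  | 0 => by simp
  | 1 => by rw [aeval_hermiteMellinPoly_one]; simp; ring
  | (K + 2) => by
    have ih1 := aeval_hermiteMellinPoly δ E (K + 1)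
    have ih0 := aeval_hermiteMellinPoly δ E K
    rw [aeval_hermiteMellinPoly_add_two, aeval_jacobiPoly_add_two, ih1, ih0, hermiteWeight_succ_cast]
    linear_combination ((((2 * K + 2 + δ) * (2 * K + 1 + δ) : ℕ) : ℂ) * (2 * I) ^ K *
      aeval E (jacobiPoly (hermiteWeight δ) K)) * I_sq

/-- `1/2 + i·(−i(s − 1/2)) = s`: the substitution `E = −i(s−1/2)`. [folklore] -/
private theorem half_add_I_mul_spectralParam (s : ℂ) : 1 / 2 + I * (-I * (s - 1 / 2)) = s := by
  have : I * (-I * (s - 1 / 2)) = -(I * I) * (s - 1 / 2) := by ring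
  rw [this, I_mul_I]; ring

/-- **Local Riemann hypothesis, archimedean place, polynomial factor** [cite: BumpEtAl2000, Thm 1]
(proof after [cite: Srednicki2011, §2]): every complex zero of the Hermite–Mellin polynomial
`Q_K = hermiteMellinPoly δ K` lies on the critical line `Re s = 1/2`. -/
theorem hermiteMellinPoly_re_eq_half (δ K : ℕ) {s : ℂ} (hs : aeval s (hermiteMellinPoly δ K) = 0) :
    s.re = 1 / 2 := by
  set E : ℂ := -I * (s - 1 / 2) with hE
  have hsE : s = 1 / 2 + I * E := (half_add_I_mul_spectralParam s).symm
  rw [hsE, aeval_hermiteMellinPoly] at hs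
  have hP : aeval E (jacobiPoly (hermiteWeight δ) K) = 0 := by
    rcases mul_eq_zero.mp hs with h | h
    · exact absurd h (pow_ne_zero _ (mul_ne_zero two_ne_zero I_ne_zero))
    · exact h
  have him := jacobiPoly_im_eq_zero_of_aeval_eq_zero (hermiteWeight_succ_pos δ) hP
  have : E.im = -(s.re - 1 / 2) := by
    rw [hE]; simp [Complex.mul_im]
  linarith

/-- Equivalent spectral form: the zeros of `Q_K` are exactly `s = 1/2 + iE` with `E` a (real) zero
of the Jacobi/Berry–Keating characteristic polynomial `P_K`. [cite: Srednicki2011, §2] -/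
theorem aeval_hermiteMellinPoly_eq_zero_iff (δ K : ℕ) (s : ℂ) :
    aeval s (hermiteMellinPoly δ K) = 0 ↔
      aeval (-I * (s - 1 / 2)) (jacobiPoly (hermiteWeight δ) K) = 0 := by
  conv_lhs => rw [← half_add_I_mul_spectralParam s, aeval_hermiteMellinPoly]
  simp [mul_ne_zero two_ne_zero I_ne_zero]

/-- The polynomial identity behind `aeval_hermiteMellinPoly`:
`Q_K = (2i)^K · P_K ∘ (−i(X − 1/2))` in `ℂ[X]`. [cite: Srednicki2011, §2] -/
theorem map_hermiteMellinPoly (δ K : ℕ) :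
    (hermiteMellinPoly δ K).map (Int.castRingHom ℂ) =
      C ((2 * I) ^ K) * ((jacobiPoly (hermiteWeight δ) K).map (algebraMap ℝ ℂ)).comp
        (C (-I) * (X - C (1 / 2 : ℂ))) := by
  apply Polynomial.funext
  intro s
  have e1 : ((hermiteMellinPoly δ K).map (Int.castRingHom ℂ)).eval s =
      aeval s (hermiteMellinPoly δ K) := by
    rw [eval_map, ← algebraMap_int_eq, ← aeval_def]
  have e2 : ∀ p : ℝ[X], (p.map (algebraMap ℝ ℂ)).eval (-I * (s - 1 / 2)) =
      aeval (-I * (s - 1 / 2)) p := fun p => by rw [eval_map, aeval_def]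
  have e3 : (C (-I) * (X - C (1 / 2 : ℂ))).eval s = -I * (s - 1 / 2) := by simp
  rw [e1, eval_mul, eval_C, eval_comp, e3, e2, ← aeval_hermiteMellinPoly δ (-I * (s - 1 / 2)) K,
    half_add_I_mul_spectralParam]

/-- Derivative form of Srednicki's identification:
`Q_K'(s) = (2i)^K · (−i) · P_K'(−i(s−1/2))`. [cite: Srednicki2011, §2] -/
theorem aeval_derivative_hermiteMellinPoly (δ K : ℕ) (s : ℂ) :
    aeval s (derivative (hermiteMellinPoly δ K)) =
      (2 * I) ^ K * (-I) * aeval (-I * (s - 1 / 2)) (derivative (jacobiPoly (hermiteWeight δ) K)) := by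
  have h := congrArg (fun p => (derivative p).eval s) (map_hermiteMellinPoly δ K)
  simp only [derivative_map, eval_map] at h
  rw [← algebraMap_int_eq, ← aeval_def] at h
  have e2 : ∀ p : ℝ[X], (p.map (algebraMap ℝ ℂ)).eval (-I * (s - 1 / 2)) =
      aeval (-I * (s - 1 / 2)) p := fun p => by rw [eval_map, aeval_def]
  have e3 : (C (-I) * (X - C (1 / 2 : ℂ))).eval s = -I * (s - 1 / 2) := by simp
  have e4 : (derivative (C (-I) * (X - C (1 / 2 : ℂ)))).eval s = -I := by simp
  rw [h, derivative_C_mul, derivative_comp, eval_mul, eval_C, eval_mul, eval_comp, e3, e4,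
    derivative_map, e2]
  ring

/-- **Simplicity of the zeros** [cite: BumpEtAl2000, Thm 1]: a zero `s` of `Q_K` is not a zero of
`Q_K'`. -/
theorem hermiteMellinPoly_derivative_ne_zero (δ K : ℕ) {s : ℂ}
    (hs : aeval s (hermiteMellinPoly δ K) = 0) : aeval s (derivative (hermiteMellinPoly δ K)) ≠ 0 := by
  rw [aeval_hermiteMellinPoly_eq_zero_iff] at hs
  rw [aeval_derivative_hermiteMellinPoly]
  refine mul_ne_zero (mul_ne_zero (pow_ne_zero _ (mul_ne_zero two_ne_zero I_ne_zero))
    (neg_ne_zero.mpr I_ne_zero)) ?_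
  exact jacobiPoly_derivative_aeval_ne_zero (hermiteWeight_succ_pos δ) hs

/-- **Functional equation** `Q_K(1 − s) = (−1)^K · Q_K(s)` — BCKV's `p_n(1−s) = ± p_n(s)` with the
sign `+` for `n ≡ 0,1 (mod 4)` and `−` for `n ≡ 2,3 (mod 4)` (`n = 2K+δ`).
[cite: BumpEtAl2000, §1, functional equation of p_n] -/
theorem hermiteMellinPoly_one_sub (δ : ℕ) (s : ℂ) : ∀ K,
    aeval (1 - s) (hermiteMellinPoly δ K) = (-1) ^ K * aeval s (hermiteMellinPoly δ K)
  | 0 => by simp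
  | 1 => by rw [aeval_hermiteMellinPoly_one, aeval_hermiteMellinPoly_one]; simp; ring
  | (K + 2) => by
    rw [aeval_hermiteMellinPoly_add_two, aeval_hermiteMellinPoly_add_two,
      hermiteMellinPoly_one_sub δ s (K + 1), hermiteMellinPoly_one_sub δ s K, pow_succ, pow_succ]
    ring

/-- `Q_K` has degree `K` (`= ⌊n/2⌋` oscillator levels of parity `δ` below `n = 2K+δ`).
[cite: Srednicki2011, §2] -/
theorem natDegree_map_hermiteMellinPoly (δ K : ℕ) :
    ((hermiteMellinPoly δ K).map (Int.castRingHom ℂ)).natDegree = K := by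
  rw [map_hermiteMellinPoly, natDegree_C_mul (pow_ne_zero _ (mul_ne_zero two_ne_zero I_ne_zero)),
    natDegree_comp, natDegree_map_eq_of_injective (algebraMap ℝ ℂ).injective, jacobiPoly_natDegree]
  have : (C (-I) * (X - C (1 / 2 : ℂ))).natDegree = 1 := by
    rw [natDegree_C_mul (neg_ne_zero.mpr I_ne_zero), natDegree_X_sub_C]
  rw [this, mul_one]

/-- Evaluation of the `ℂ`-image of `Q_K` is `aeval`. [folklore] -/
private theorem eval_map_hermiteMellinPoly (δ K : ℕ) (s : ℂ) :
    ((hermiteMellinPoly δ K).map (Int.castRingHom ℂ)).eval s = aeval s (hermiteMellinPoly δ K) := by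
  rw [eval_map, ← algebraMap_int_eq, ← aeval_def]

/-- `Q_K ≠ 0` in `ℂ[X]`. [cite: BumpEtAl2000, Thm 1] -/
theorem map_hermiteMellinPoly_ne_zero (δ K : ℕ) :
    (hermiteMellinPoly δ K).map (Int.castRingHom ℂ) ≠ 0 := by
  intro h
  have h0 : aeval (0 : ℂ) (hermiteMellinPoly δ K) = 0 := by
    rw [← eval_map_hermiteMellinPoly, h, eval_zero]
  have := hermiteMellinPoly_re_eq_half δ K h0
  norm_num at this

/-- **Counting form of the local Riemann hypothesis** (what the finite-level certificates check:
`K` distinct simple zeros, all on the line): the complex roots of `Q_K` form a multiset of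
cardinality `K` without repetition, contained in `{Re s = 1/2}`.
[cite: BumpEtAl2000, Thm 1] [cite: Srednicki2011, §2] -/
theorem roots_map_hermiteMellinPoly (δ K : ℕ) :
    Multiset.card ((hermiteMellinPoly δ K).map (Int.castRingHom ℂ)).roots = K ∧
    ((hermiteMellinPoly δ K).map (Int.castRingHom ℂ)).roots.Nodup ∧
    ∀ s ∈ ((hermiteMellinPoly δ K).map (Int.castRingHom ℂ)).roots, s.re = 1 / 2 := by
  set P := (hermiteMellinPoly δ K).map (Int.castRingHom ℂ) with hP
  have hP0 : P ≠ 0 := map_hermiteMellinPoly_ne_zero δ K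
  refine ⟨?_, ?_, ?_⟩
  · rw [← (IsAlgClosed.splits P).natDegree_eq_card_roots, hP, natDegree_map_hermiteMellinPoly]
  · classical
    refine Multiset.nodup_iff_count_le_one.mpr fun s => ?_
    rw [count_roots]
    by_contra hlt
    push Not at hlt
    obtain ⟨h1, h2⟩ := (one_lt_rootMultiplicity_iff_isRoot hP0).mp hlt
    rw [IsRoot.def, hP, eval_map_hermiteMellinPoly] at h1
    rw [IsRoot.def, hP, derivative_map, eval_map, ← algebraMap_int_eq, ← aeval_def] at h2
    exact hermiteMellinPoly_derivative_ne_zero δ K h1 h2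
  · intro s hs
    have h := (mem_roots hP0).mp hs
    rw [IsRoot.def, hP, eval_map_hermiteMellinPoly] at h
    exact hermiteMellinPoly_re_eq_half δ K h

end Hermite

end LocalRH

end Literature.NumberTheory.LFunctions
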